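import Mathlib
import Summits.Ventures.PercRepro.TriangleCapFourRowTwo

/-!
# PercRepro — THE NON-BIPARTITE SECOND-ORDER LOCUS OF THE CELL `(k, 4, 2)`, THE STRICT CASES: the convexity with
every degree `≥ 4`, the cross-row deletion, and the degree-`3` deletion with the `K₄⁻`-refinement (p3, gen 45;
part 201a′)

On the cell `(k, 4, 2)` the non-`4`-bipartite second-best value is `m k − 2 (k − 3) − 2 (k − 9)` (part 198). The
cases of part 198b's degree argument that cannot attain it:
* `four_two_convex_strict`: every degree in `[4, k − 5]` is `4k − 30 ≥ T + 2` below (`k ≥ 10`).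
* `four_two_del_three_strict` (`k ≥ 11`, every degree `≤ k − 4`): a vertex `z` of degree `3` is strictly below —
  `D − z` on the cell `(k − 1, 4, 1)` is `4`-bipartite with the neighbours of `z` all in `A′` (`D` `4`-bipartite) or
  `T(z) ≤ 2k − 7`: with two neighbours `x, x′` in `A′` and one, `y`, off it, `K₄⁻`-freeness forbids `y ∼ x` and
  `y ∼ x′` together, so `d′(y) ≤ 3` (`four_two_del_three_T`); or `D − z` is `(k − 3) + 6 (k − 10)` below, with
  room `4k − 42`.
* `four_two_cross_strict'` (`k ≥ 11`, every degree `≤ k − 4`): a vertex of degree `d ≤ 1` is deleted onto the cell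
  `(k − 1, 5, k + d − 12)` of the closed form, strictly below (`d = 0` at `k = 11` is impossible by the envelope).
Axioms: standard.
-/

namespace PercRepro

namespace TriangleCap

namespace C047

open Finset

variable {V : Type*} [Fintype V] [DecidableEq V]

omit [DecidableEq V] in
/-- **EVERY DEGREE IN `[4, k − 5]` ON THE CELL `(k, 4, 2)` IS STRICT:** `Σ_v d(v)² + 2 (k − 3) + 2 (k − 9) + 2 ≤ m k`
for `10 ≤ k` (the convexity gives `4k − 30`). -/
theorem four_two_convex_strict (D : SimpleGraph V) [DecidableRel D.Adj] (hk : 10 ≤ Fintype.card V)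
    (hm : D.edgeFinset.card + 2 = 4 * (Fintype.card V - 4)) (hcap : ∀ v, deg D v + 5 ≤ Fintype.card V)
    (hdeg : ∀ v, 4 ≤ deg D v) :
    ∑ v, deg D v * deg D v + 2 * (Fintype.card V - 3) + 2 * (Fintype.card V - 9) + 2 ≤
      D.edgeFinset.card * Fintype.card V := by
  have hsum : ∑ v, (deg D v * deg D v + 4 * (Fintype.card V - 5)) ≤ ∑ v, (Fintype.card V - 1) * deg D v :=
    sum_le_sum (fun v _ => convex_vertex_four_two (deg D v) (Fintype.card V) (hdeg v) (hcap v))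
  rw [sum_add_distrib, sum_const, card_univ, smul_eq_mul, ← mul_sum, sum_deg_eq] at hsum
  obtain ⟨k, hk'⟩ : ∃ k, Fintype.card V = k := ⟨_, rfl⟩
  obtain ⟨S, hS⟩ : ∃ S, ∑ v, deg D v * deg D v = S := ⟨_, rfl⟩
  obtain ⟨m, hmdef⟩ : ∃ m, D.edgeFinset.card = m := ⟨_, rfl⟩
  rw [hk'] at hsum hm hk
  rw [hS, hmdef] at hsum
  rw [hmdef] at hm
  rw [hS, hk', hmdef]
  obtain ⟨t, rfl⟩ : ∃ t, k = t + 10 := ⟨k - 10, by omega⟩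
  have hm' : m = 4 * t + 22 := by omega
  subst hm'
  have e1 : t + 10 - 5 = t + 5 := by omega
  have e2 : t + 10 - 1 = t + 9 := by omega
  have e3 : t + 10 - 3 = t + 7 := by omega
  have e4 : t + 10 - 9 = t + 1 := by omega
  rw [e1, e2] at hsum
  rw [e3, e4]
  nlinarith [hsum]

/-- **A VERTEX OF DEGREE `≤ 1` ON THE CELL `(k, 4, 2)` IS STRICT:** the cross-row gap `B2 = 4 (k − 9) ≥ 2 (k − 9) + 2`
for `k ≥ 10`. -/
theorem four_two_cross_strict (D : SimpleGraph V) [DecidableRel D.Adj] (hK : K4mFree D)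
    (hk : 10 ≤ Fintype.card V) (hm : D.edgeFinset.card + 2 = 4 * (Fintype.card V - 4))
    (hcap : ∀ v, deg D v + 5 ≤ Fintype.card V) (z : V) (hz : deg D z ≤ 1) :
    ∑ v, deg D v * deg D v + 2 * (Fintype.card V - 3) + 2 * (Fintype.card V - 9) + 2 ≤
      D.edgeFinset.card * Fintype.card V := by
  have h := below_cross_gen D hK 4 2 (by norm_num) (by omega) hm hcap z (by omega)
  have e1 : Fintype.card V - 1 - 2 = Fintype.card V - 3 := by omega
  have e2 : Fintype.card V - 2 * 4 - 1 = Fintype.card V - 9 := by omega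
  rw [e1, e2] at h
  omega

/-- **THE NEIGHBOUR COUNT OF A DEGREE-`3` VERTEX OVER A BIPARTITE `D − z`, REFINED BY `K₄⁻`-FREENESS:** `D − z ⊆ K(A′, A′ᶜ)`
with `|A′| = 4`, `9 ≤ k′`, `d(z) = 3`, some neighbour of `z` off `A′` ⇒ `Σ_{w ∼ z} d′(w) ≤ 2 (k′ − 4) + 3`: with
two neighbours `x, x′` in `A′` and one, `y`, off it, `y` is adjacent to at most one of `x, x′` (`not_adj_both` on
the triangle `y z x`), so `d′(y) ≤ 3`. -/
theorem four_two_del_three_T (D : SimpleGraph V) [DecidableRel D.Adj] (hK : K4mFree D) (z : V)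
    (A' : Finset {v : V // v ≠ z}) (hsub : BipSub (del D z) A') (hA' : A'.card = 4)
    (hk' : 2 * 4 + 1 ≤ Fintype.card {v : V // v ≠ z}) (hz : deg D z = 3) (w₀ : {v : V // v ≠ z})
    (hw₀ : D.Adj w₀.1 z) (hw₀A : w₀ ∉ A') :
    ∑ w : {v : V // v ≠ z}, (if D.Adj w.1 z then deg (del D z) w else 0) ≤
      2 * (Fintype.card {v : V // v ≠ z} - 4) + 3 := by
  obtain ⟨S, hS⟩ : ∃ S : Finset {v : V // v ≠ z}, S = univ.filter (fun w => D.Adj w.1 z) := ⟨_, rfl⟩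
  have hScard : S.card = 3 := by rw [hS, card_nbhd_del, hz]
  have hmemS : ∀ w, w ∈ S ↔ D.Adj w.1 z := fun w => by rw [hS, mem_filter]; simp only [mem_univ, true_and]
  rw [← sum_filter, ← hS]
  have hsplit := card_filter_add_card_filter_not (s := S) (p := fun w => w ∈ A')
  have hO : 1 ≤ (S.filter (fun w => w ∉ A')).card := by
    apply card_pos.mpr
    exact ⟨w₀, mem_filter.mpr ⟨(hmemS w₀).mpr hw₀, hw₀A⟩⟩
  have hin_le : ∀ w ∈ S, w ∈ A' → deg (del D z) w ≤ Fintype.card {v : V // v ≠ z} - 4 := by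
    intro w _ hw
    have := deg_le_of_bipSub_mem (del D z) A' hsub w hw
    rw [hA'] at this
    exact this
  have hoff_le : ∀ w ∈ S, w ∉ A' → deg (del D z) w ≤ 4 := by
    intro w _ hw
    have := deg_le_card_of_bipSub (del D z) A' hsub w hw
    rw [hA'] at this
    exact this
  rcases Nat.lt_or_ge (S.filter (fun w => w ∈ A')).card 2 with hI | hI
  · -- at most one neighbour in `A′`: the crude count
    have h1 : ∑ w ∈ S, deg (del D z) w ≤
        ∑ w ∈ S, (if w ∈ A' then Fintype.card {v : V // v ≠ z} - 4 else 4) := by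
      apply sum_le_sum
      intro w hw
      by_cases hwA : w ∈ A'
      · simp only [hwA, if_true]; exact hin_le w hw hwA
      · simp only [hwA, if_false]; exact hoff_le w hw hwA
    rw [sum_ite, sum_const, sum_const, smul_eq_mul, smul_eq_mul] at h1
    rw [hScard] at hsplit
    have hc : 5 ≤ Fintype.card {v : V // v ≠ z} - 4 := by omega
    rcases Nat.lt_or_ge (S.filter (fun w => w ∈ A')).card 1 with hI0 | hI1
    · have hI0' : (S.filter (fun w => w ∈ A')).card = 0 := by omega
      rw [hI0'] at h1 hsplit
      omega
    · have hI1' : (S.filter (fun w => w ∈ A')).card = 1 := by omega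
      rw [hI1'] at h1 hsplit
      omega
  · -- exactly two neighbours `x, x′` in `A′` and one, `y`, off it
    have hI2 : (S.filter (fun w => w ∈ A')).card = 2 := by omega
    have hO1 : (S.filter (fun w => w ∉ A')).card = 1 := by omega
    obtain ⟨x, x', hxx', hpair⟩ := card_eq_two.mp hI2
    obtain ⟨y, hy⟩ := card_eq_one.mp hO1
    have hxS : x ∈ S.filter (fun w => w ∈ A') := by rw [hpair]; exact mem_insert_self _ _
    have hx'S : x' ∈ S.filter (fun w => w ∈ A') := by rw [hpair]; exact mem_insert_of_mem (mem_singleton_self _)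
    have hyS : y ∈ S.filter (fun w => w ∉ A') := by rw [hy]; exact mem_singleton_self _
    rw [mem_filter] at hxS hx'S hyS
    -- `y` is adjacent to at most one of `x, x′` in `D − z`
    have hnot : ¬ ((del D z).Adj y x ∧ (del D z).Adj y x') := by
      rintro ⟨h1, h2⟩
      unfold del at h1 h2
      exact not_adj_both D hK (u := y.1) (v := z) (w := x.1) (x := x'.1) ((hmemS y).mp hyS.1) h1
        (D.adj_symm ((hmemS x).mp hxS.1)) (fun h => hxx' (Subtype.ext h)) h2 (D.adj_symm ((hmemS x').mp hx'S.1))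
    have hdy : deg (del D z) y ≤ 3 := by
      unfold deg
      have hsub1 : univ.filter (fun w => (del D z).Adj y w) ⊆ A'.erase (if (del D z).Adj y x then x' else x) := by
        intro w hw
        rw [mem_filter] at hw
        rw [mem_erase]
        refine ⟨?_, ?_⟩
        · by_cases hyx : (del D z).Adj y x
          · rw [if_pos hyx]
            intro hwx'
            exact hnot ⟨hyx, hwx' ▸ hw.2⟩
          · rw [if_neg hyx]
            intro hwx
            exact hyx (hwx ▸ hw.2)
        · have := hsub y w hw.2
          tauto
      have := card_le_card hsub1
      rw [card_erase_of_mem (by split_ifs <;> [exact hx'S.2; exact hxS.2]), hA'] at this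
      exact this
    -- the sum over `S = {x, x′, y}`
    have hxy : x ≠ y := fun h => hyS.2 (h ▸ hxS.2)
    have hx'y : x' ≠ y := fun h => hyS.2 (h ▸ hx'S.2)
    have hxnot : x ∉ ({x', y} : Finset {v : V // v ≠ z}) := by
      simp only [mem_insert, mem_singleton]
      exact fun h => h.elim hxx' hxy
    have hSeq : S = {x, x', y} := by
      symm
      apply eq_of_subset_of_card_le
      · intro w hw
        simp only [mem_insert, mem_singleton] at hw
        rcases hw with rfl | rfl | rfl
        · exact hxS.1
        · exact hx'S.1
        · exact hyS.1
      · rw [hScard, card_insert_of_notMem hxnot, card_pair hx'y]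
    rw [hSeq, sum_insert hxnot, sum_pair hx'y]
    have h1 := hin_le x hxS.1 hxS.2
    have h2 := hin_le x' hx'S.1 hx'S.2
    omega

/-- The arithmetic of the strict degree-`3` deletion onto a `4`-bipartite `D − z` with one missing pair:
`T ≤ 2 (k − 1 − 4) + 3` closes with room `2`. -/
theorem four_two_del_three_bip_strict_arith (k m m' S' T : ℕ) (hk : 11 ≤ k) (hm : m + 2 = 4 * (k - 4))
    (hm' : m' + 3 = m) (hS' : S' + 1 * (k - 1 - 1 - 1) ≤ m' * (k - 1)) (hT : T ≤ 2 * (k - 1 - 4) + 3) :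
    S' + 2 * T + 3 + 3 * 3 + 2 * (k - 3) + 2 * (k - 9) + 2 ≤ m * k := by
  obtain ⟨t, rfl⟩ : ∃ t, k = t + 11 := ⟨k - 11, by omega⟩
  have hm1 : m = 4 * t + 26 := by omega
  have hm2 : m' = 4 * t + 23 := by omega
  subst hm1 hm2
  have e1 : t + 11 - 1 = t + 10 := by omega
  have e2 : t + 11 - 1 - 1 - 1 = t + 8 := by omega
  have e3 : t + 11 - 3 = t + 8 := by omega
  have e4 : t + 11 - 9 = t + 2 := by omega
  have e5 : t + 11 - 1 - 4 = t + 6 := by omega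
  rw [e2, e1] at hS'
  rw [e5] at hT
  rw [e3, e4]
  nlinarith [hS', hT]

/-- The arithmetic of the strict degree-`3` deletion onto a non-`4`-bipartite `D − z`, the neighbours at `≤ k − 5`
in `D − z` (room `4k − 42 ≥ 2` for `k ≥ 11`). -/
theorem four_two_del_three_gap_strict_arith (k m m' S' T : ℕ) (hk : 11 ≤ k) (hm : m + 2 = 4 * (k - 4))
    (hm' : m' + 3 = m) (hS' : S' + (k - 1 - 2) + 2 * (k - 1 - 2 * 4 - 1) * (4 - 1) ≤ m' * (k - 1))
    (hT : T ≤ 3 * (k - 5)) :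
    S' + 2 * T + 3 + 3 * 3 + 2 * (k - 3) + 2 * (k - 9) + 2 ≤ m * k := by
  obtain ⟨t, rfl⟩ : ∃ t, k = t + 11 := ⟨k - 11, by omega⟩
  have hm1 : m = 4 * t + 26 := by omega
  have hm2 : m' = 4 * t + 23 := by omega
  subst hm1 hm2
  have e1 : t + 11 - 1 = t + 10 := by omega
  have e2 : t + 11 - 1 - 2 = t + 8 := by omega
  have e3 : t + 11 - 1 - 2 * 4 - 1 = t + 1 := by omega
  have e4 : t + 11 - 3 = t + 8 := by omega
  have e5 : t + 11 - 9 = t + 2 := by omega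
  have e6 : t + 11 - 5 = t + 6 := by omega
  rw [e3, e2, e1] at hS'
  rw [e6] at hT
  rw [e4, e5]
  nlinarith [hS', hT]

/-- **A VERTEX OF DEGREE `3` ON THE CELL `(k, 4, 2)`, `11 ≤ k`, EVERY DEGREE `≤ k − 4`, IS STRICT:** `D` is
`4`-bipartite or `Σ_v d(v)² + 2 (k − 3) + 2 (k − 9) + 2 ≤ m k`. -/
theorem four_two_del_three_strict (D : SimpleGraph V) [DecidableRel D.Adj] (hK : K4mFree D)
    (hk : 11 ≤ Fintype.card V) (hm : D.edgeFinset.card + 2 = 4 * (Fintype.card V - 4))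
    (hcap : ∀ v, deg D v + 4 ≤ Fintype.card V) (z : V) (hz : deg D z = 3) :
    (∃ A : Finset V, A.card = 4 ∧ BipSub D A) ∨
      ∑ v, deg D v * deg D v + 2 * (Fintype.card V - 3) + 2 * (Fintype.card V - 9) + 2 ≤
        D.edgeFinset.card * Fintype.card V := by
  have hK' := k4mFree_del D hK z
  have hcard' := card_del z
  have hedges' := card_edges_del D z
  have hsq := sum_deg_sq_del D z
  rw [hz] at hedges' hsq
  obtain ⟨k, hk'⟩ : ∃ k, Fintype.card V = k := ⟨_, rfl⟩
  have hcardW' : Fintype.card {v : V // v ≠ z} = k - 1 := by omega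
  obtain ⟨m, hmdef⟩ : ∃ m, D.edgeFinset.card = m := ⟨_, rfl⟩
  obtain ⟨m', hm'def⟩ : ∃ m', (del D z).edgeFinset.card = m' := ⟨_, rfl⟩
  rw [hmdef] at hedges' hm
  rw [hm'def] at hedges'
  rw [hk'] at hm hk hcap
  have hm' : (del D z).edgeFinset.card + 1 = 4 * (Fintype.card {v : V // v ≠ z} - 4) := by
    rw [hm'def, hcardW']
    have e : 4 * (k - 4) = 4 * (k - 1 - 4) + 4 := by omega
    omega
  obtain ⟨T, hTdef⟩ : ∃ T, ∑ w : {v : V // v ≠ z}, (if D.Adj w.1 z then deg (del D z) w else 0) = T := ⟨_, rfl⟩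
  obtain ⟨S', hS'def⟩ : ∃ S', ∑ w : {v : V // v ≠ z}, deg (del D z) w * deg (del D z) w = S' := ⟨_, rfl⟩
  rw [hTdef, hS'def] at hsq
  rcases one_below_second_order_gen (del D z) hK' 4 (le_refl 4) (by omega) hm' with ⟨A', hA'card, hA'⟩ | hgap
  · by_cases hin : ∀ w : {v : V // v ≠ z}, D.Adj w.1 z → w ∈ A'
    · obtain ⟨B, hBcard, hB⟩ := bipSub_lift D z A' hA' hin
      exact Or.inl ⟨B, by rw [hBcard, hA'card], hB⟩
    · right
      push Not at hin
      obtain ⟨w₀, hw₀, hw₀A⟩ := hin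
      have hT := four_two_del_three_T D hK z A' hA' hA'card (by omega) hz w₀ hw₀ hw₀A
      rw [hTdef, hcardW'] at hT
      have hS' := sum_deg_sq_le_of_bipSub (del D z) A' hA' 4 1 hA'card hm' (by omega)
      rw [hS'def, hm'def, hcardW'] at hS'
      rw [hsq, hmdef, hk']
      exact four_two_del_three_bip_strict_arith k m m' S' T hk hm hedges' hS' hT
  · right
    have hT := sum_del_nbhd_le D z (k - 5) (fun v => by have := hcap v; omega)
    rw [hTdef, hz] at hT
    rw [hS'def, hm'def, hcardW'] at hgap
    rw [hsq, hmdef, hk']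
    exact four_two_del_three_gap_strict_arith k m m' S' T hk hm hedges' hgap hT

/-- The arithmetic of the strict cross-row deletion on `(k, 4, 2)`, `k ≥ 11`, `d ≤ 1`, `D − z` on the cell
`(k − 1, 5, k + d − 12)`, the neighbour at `≤ k − 5`; `d = 0` needs `k ≥ 12`. -/
theorem four_two_cross_strict_arith (k m m' S' T d : ℕ) (hk : 11 ≤ k) (hd : d ≤ 1) (hk0 : d = 0 → 12 ≤ k)
    (hm : m + 2 = 4 * (k - 4)) (hm' : m' + d = m)
    (hS' : S' + (k + d - 12) * (k - 1 - 1 - (k + d - 12)) ≤ m' * (k - 1)) (hT : T ≤ d * (k - 5)) :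
    S' + 2 * T + d + d * d + 2 * (k - 3) + 2 * (k - 9) + 2 ≤ m * k := by
  interval_cases d
  · obtain ⟨t, rfl⟩ : ∃ t, k = t + 12 := ⟨k - 12, by omega⟩
    have hm1 : m = 4 * t + 30 := by omega
    have hm2 : m' = 4 * t + 30 := by omega
    subst hm1 hm2
    have e1 : t + 12 + 0 - 12 = t := by omega
    have e2 : t + 12 - 1 - 1 - t = 10 := by omega
    have e3 : t + 12 - 1 = t + 11 := by omega
    have e4 : t + 12 - 3 = t + 9 := by omega
    have e5 : t + 12 - 9 = t + 3 := by omega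
    rw [e1, e2, e3] at hS'
    rw [e4, e5]
    nlinarith [hS', hT]
  · obtain ⟨t, rfl⟩ : ∃ t, k = t + 11 := ⟨k - 11, by omega⟩
    have hm1 : m = 4 * t + 26 := by omega
    have hm2 : m' = 4 * t + 25 := by omega
    subst hm1 hm2
    have e1 : t + 11 + 1 - 12 = t := by omega
    have e2 : t + 11 - 1 - 1 - t = 9 := by omega
    have e3 : t + 11 - 1 = t + 10 := by omega
    have e4 : t + 11 - 3 = t + 8 := by omega
    have e5 : t + 11 - 9 = t + 2 := by omega
    have e6 : t + 11 - 5 = t + 6 := by omega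
    rw [e1, e2, e3] at hS'
    rw [e6] at hT
    rw [e4, e5]
    nlinarith [hS', hT]

/-- **A VERTEX OF DEGREE `≤ 1` ON THE CELL `(k, 4, 2)`, `11 ≤ k`, EVERY DEGREE `≤ k − 4`, IS STRICT:** the cross-row
deletion onto the cell `(k − 1, 5, k + d − 12)` of the closed form (`d = 0` at `k = 11` is impossible: `26` edges
on `10` vertices). -/
theorem four_two_cross_strict' (D : SimpleGraph V) [DecidableRel D.Adj] (hK : K4mFree D)
    (hk : 11 ≤ Fintype.card V) (hm : D.edgeFinset.card + 2 = 4 * (Fintype.card V - 4))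
    (hcap : ∀ v, deg D v + 4 ≤ Fintype.card V) (z : V) (hz : deg D z ≤ 1) :
    ∑ v, deg D v * deg D v + 2 * (Fintype.card V - 3) + 2 * (Fintype.card V - 9) + 2 ≤
      D.edgeFinset.card * Fintype.card V := by
  have hK' := k4mFree_del D hK z
  have hcard' := card_del z
  have hedges' := card_edges_del D z
  have hsq := sum_deg_sq_del D z
  have hT := sum_del_nbhd_le D z (Fintype.card V - 5) (fun v => by have := hcap v; omega)
  have henv := four_mul_card_edges_le_sq (del D z) hK' (by omega)
  obtain ⟨k, hk'⟩ : ∃ k, Fintype.card V = k := ⟨_, rfl⟩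
  have hcardW' : Fintype.card {v : V // v ≠ z} = k - 1 := by omega
  obtain ⟨d, hd⟩ : ∃ d, deg D z = d := ⟨_, rfl⟩
  rw [hd] at hz hedges' hsq hT
  obtain ⟨m, hmdef⟩ : ∃ m, D.edgeFinset.card = m := ⟨_, rfl⟩
  obtain ⟨m', hm'def⟩ : ∃ m', (del D z).edgeFinset.card = m' := ⟨_, rfl⟩
  rw [hmdef] at hedges' hm
  rw [hm'def] at hedges' henv
  rw [hk'] at hm hk hT
  rw [hcardW'] at henv
  have hk0 : d = 0 → 12 ≤ k := by
    intro hd0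
    by_contra hlt
    have hk11 : k = 11 := by omega
    rw [hk11] at henv
    norm_num at henv
    omega
  have hm'' : (del D z).edgeFinset.card + 5 * 5 + (k + d - 12) = 5 * Fintype.card {v : V // v ≠ z} := by
    rw [hm'def, hcardW']
    have := hk0
    interval_cases d <;> omega
  have hS' := closed_form_stability (del D z) hK' 5 (k + d - 12) (by norm_num) (by rw [hcardW']; omega) hm''
  obtain ⟨T, hTdef⟩ : ∃ T, ∑ w : {v : V // v ≠ z}, (if D.Adj w.1 z then deg (del D z) w else 0) = T := ⟨_, rfl⟩
  obtain ⟨S', hS'def⟩ : ∃ S', ∑ w : {v : V // v ≠ z}, deg (del D z) w * deg (del D z) w = S' := ⟨_, rfl⟩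
  rw [hTdef, hS'def] at hsq
  rw [hTdef] at hT
  rw [hS'def, hm'def, hcardW'] at hS'
  rw [hsq, hmdef, hk']
  exact four_two_cross_strict_arith k m m' S' T d hk hz hk0 hm hedges' hS' hT

end C047

end TriangleCap

end PercRepro
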